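import Summits.AtomisticToContinuum.HydrodynamicLimit.Theorems.StiffCollisionalRelaxationAprioriBoundsFibreDefs
import Summits.AtomisticToContinuum.HydrodynamicLimit.Theorems.StiffCollisionalRelaxationAprioriBoundsTruncationTools
import HarnessLib

/-!
# Layer cake and the time-integrated Markov–Tonelli step for `stub_partOnePrime` (line `fibre-deficit-transfer`)

Supporting file of the line `fibre-deficit-transfer` for the crux `AprioriBounds`
(stmt-AtomisticToContinuum-14827; `StiffCollisionalRelaxation.AprioriBounds` =
`CollisionIsometryCLT.AprioriBoundsPreShock`), lead prover `prover-line-stmt-AtomisticToContinuum-14827-a1-0`,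
skeleton r4 (RATE-FREE, TIME-INTEGRATED (i)-chain), stub 6 `stub_partOnePrime`
(`IntegratedBulkTailAt ∧ FarTailAllAt ⇒ PartOneAt`).  This file holds the particle-number-wise, model-independent
half of that stub (registered sub-goal `partOnePrime_markov_step`); the dial, the choice of the level cut and the
assembly are in `…FibrePartOnePrime.lean`.

* `pp_ofReal_exp_mul_le_tsum`, `pp_ofReal_expAvg_le_tsum` — THE LAYER CAKE: for `λ ≥ 0`,
  `e^{λ|v|²} ≤ ∑_{K ∈ ℕ} e^{λ(K+1)} 𝟙{K ≤ |v|²}` (take the term `K = ⌊|v|²⌋`), hence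
  `(N+1)⁻¹∑ᵢ e^{λ|vᵢ|²} ≤ ∑_K e^{λ(K+1)} frac_K` (in `ℝ≥0∞`, where every series converges).
* `pp_ofReal_frac_le_add_indicator` — `frac_K ≤ thr + 𝟙{thr < frac_K}` (uses `frac_K ≤ 1`).
* `pp_lintegral_orbit_expAvg_le` — on a good orbit, integrating the layer cake over `[0, t]` and splitting the
  levels at `M`: `∫₀ᵗ G ≤ D + R¹(z) + R²(z)` with the deterministic bulk part
  `D = t ∑_{K<M} e^{λ(K+1)} thr_K`, the bulk bad-event part `R¹(z) = ∑_{K<M} e^{λ(K+1)} ∫₀ᵗ 𝟙{thr_K < frac_K(Φ_s z)} ds`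
  and the far part `R²(z) = ∑_{j} e^{λ(j+M+1)} ∫₀ᵗ frac_{j+M}(Φ_s z) ds`.
* `partOnePrime_markov_step` — for a probability law carried by the good set: if `t ∑_{K<M} e^{λ(K+1)} thr_K ≤ tC + 1/2`,
  the bulk bad events have TIME-INTEGRATED probability `∫₀ᵗ P{thr_K < frac_K(Φ_s ·)} ds ≤ p` (`K < M`), and the
  weighted far occupations are dominated by a geometric series `B ρ^j`, then
  `P{tC + 1 < ∫₀ᵗ (N+1)⁻¹∑ᵢ e^{λ|vᵢ(s)|²} ds} ≤ 2 (p ∑_{K<M} e^{λ(K+1)} + B/(1 − ρ))`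
  (on a good orbit the Bochner time integral is the lower Lebesgue one — the integrand is bounded by `e^{2λE(z)}`,
  energy conservation — so the bad event forces `1/2 ≤ R¹ + R²`; Markov, then Tonelli on `good × [0,t]` through
  `AdiabatCeiling.aemeasurable_comp_flow_prod₂`; `E R¹ = ∑_{K<M} e^{λ(K+1)} ∫₀ᵗ P{bad(K,s)} ds` IS time-integrated).

The `pp_` lemmas are adapted from the rated sibling `…FibrePartOneOfTailsA.lean` (`stub_partOne_of_tails`), whose
Markov step takes the bulk hypothesis uniformly in `s`; here it is taken in the time-integrated form that the
rate-free transfer (`IntegratedBulkTailAt`) delivers.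

No new definitions, no named facts; axioms `propext`, `Classical.choice`, `Quot.sound`.
-/

noncomputable section

open MeasureTheory Filter Set Topology
open scoped ENNReal

namespace Summit.AtomisticToContinuum.HydrodynamicLimit.Theorems.FibreDeficitTransfer

open Literature.MathematicalPhysics.KineticTheory Literature.Analysis.FluidPDE
open Summit.AtomisticToContinuum.HydrodynamicLimit.Theorems.AprioriBoundsNegative (PartOneAt PartTwoAt)
open Summit.AtomisticToContinuum.HydrodynamicLimit.Theorems.VisitLedgerUpscattering (Cfg Flow Flows NiceProfiles)
open Summit.AtomisticToContinuum.HydrodynamicLimit.Theorems.AdiabatCeiling (aemeasurable_comp_flow_prod₂)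

/-! ## The layer cake -/

-- adapted from …FibrePartOneOfTailsA.lean (`ofReal_exp_mul_le_tsum`)
/-- One particle: `e^{λq} ≤ ∑_{K ∈ ℕ} e^{λ(K+1)} 𝟙{K ≤ q}` for `q, λ ≥ 0` (the term `K = ⌊q⌋` already
dominates, since `q < ⌊q⌋ + 1`). -/
theorem pp_ofReal_exp_mul_le_tsum {lam q : ℝ} (hlam : 0 ≤ lam) (hq : 0 ≤ q) :
    ENNReal.ofReal (Real.exp (lam * q)) ≤
      ∑' K : ℕ, ENNReal.ofReal (Real.exp (lam * ((K : ℝ) + 1))) * (if (K : ℝ) ≤ q then 1 else 0) := by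
  have hfl : ((⌊q⌋₊ : ℕ) : ℝ) ≤ q := Nat.floor_le hq
  have hlt : q < ((⌊q⌋₊ : ℕ) : ℝ) + 1 := Nat.lt_floor_add_one q
  calc ENNReal.ofReal (Real.exp (lam * q))
      ≤ ENNReal.ofReal (Real.exp (lam * (((⌊q⌋₊ : ℕ) : ℝ) + 1))) :=
        ENNReal.ofReal_le_ofReal (Real.exp_le_exp.2 (mul_le_mul_of_nonneg_left hlt.le hlam))
    _ = ENNReal.ofReal (Real.exp (lam * (((⌊q⌋₊ : ℕ) : ℝ) + 1))) *
          (if ((⌊q⌋₊ : ℕ) : ℝ) ≤ q then 1 else 0) := by rw [if_pos hfl, mul_one]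
    _ ≤ ∑' K : ℕ, ENNReal.ofReal (Real.exp (lam * ((K : ℝ) + 1))) * (if (K : ℝ) ≤ q then 1 else 0) :=
        ENNReal.le_tsum ⌊q⌋₊

-- adapted from …FibrePartOneOfTailsA.lean (`ofReal_expAvg_le_tsum`)
/-- **The layer cake for the empirical exponential moment**: for `λ ≥ 0` and every configuration `w`,
`(N+1)⁻¹∑ᵢ e^{λ|vᵢ|²} ≤ ∑_{K ∈ ℕ} e^{λ(K+1)} frac_K(w)` (in `ℝ≥0∞`). -/
theorem pp_ofReal_expAvg_le_tsum {N : ℕ} {lam : ℝ} (hlam : 0 ≤ lam) (w : Cfg N) :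
    ENNReal.ofReal (((N + 1 : ℕ) : ℝ)⁻¹ * ∑ i, Real.exp (lam * ‖(w i).2‖ ^ 2)) ≤
      ∑' K : ℕ, ENNReal.ofReal (Real.exp (lam * ((K : ℝ) + 1))) * ENNReal.ofReal (frac (K : ℝ) w) := by
  have hn : (0 : ℝ) ≤ ((N + 1 : ℕ) : ℝ)⁻¹ := by positivity
  have hfrac : ∀ K : ℕ, ENNReal.ofReal (frac (K : ℝ) w) =
      ENNReal.ofReal (((N + 1 : ℕ) : ℝ)⁻¹) * ∑ i, (if (K : ℝ) ≤ ‖(w i).2‖ ^ 2 then (1 : ℝ≥0∞) else 0) := by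
    intro K
    rw [frac_eq_avg, ENNReal.ofReal_mul hn,
      ENNReal.ofReal_sum_of_nonneg (fun i _ => by split_ifs <;> norm_num)]
    congr 1
    refine Finset.sum_congr rfl fun i _ => ?_
    split_ifs
    · exact ENNReal.ofReal_one
    · exact ENNReal.ofReal_zero
  simp_rw [hfrac]
  rw [ENNReal.ofReal_mul hn, ENNReal.ofReal_sum_of_nonneg (fun i _ => (Real.exp_pos _).le)]
  calc ENNReal.ofReal (((N + 1 : ℕ) : ℝ)⁻¹) * ∑ i, ENNReal.ofReal (Real.exp (lam * ‖(w i).2‖ ^ 2))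
      ≤ ENNReal.ofReal (((N + 1 : ℕ) : ℝ)⁻¹) * ∑ i, ∑' K : ℕ, ENNReal.ofReal (Real.exp (lam * ((K : ℝ) + 1))) *
          (if (K : ℝ) ≤ ‖(w i).2‖ ^ 2 then 1 else 0) :=
        mul_le_mul' le_rfl (Finset.sum_le_sum fun i _ => pp_ofReal_exp_mul_le_tsum hlam (sq_nonneg _))
    _ = ∑' K : ℕ, ENNReal.ofReal (Real.exp (lam * ((K : ℝ) + 1))) *
          (ENNReal.ofReal (((N + 1 : ℕ) : ℝ)⁻¹) * ∑ i, (if (K : ℝ) ≤ ‖(w i).2‖ ^ 2 then (1 : ℝ≥0∞) else 0)) := by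
        rw [← Summable.tsum_finsetSum (fun i _ => ENNReal.summable), ← ENNReal.tsum_mul_left]
        refine tsum_congr fun K => ?_
        rw [Finset.mul_sum, Finset.mul_sum, Finset.mul_sum]
        refine Finset.sum_congr rfl fun i _ => ?_
        ring

-- adapted from …FibrePartOneOfTailsA.lean (`ofReal_frac_le_add_indicator`)
/-- `frac_K ≤ thr + 𝟙{thr < frac_K}` in `ℝ≥0∞` (because `frac_K ≤ 1`). -/
theorem pp_ofReal_frac_le_add_indicator {N : ℕ} (thr K : ℝ) (w : Cfg N) :
    ENNReal.ofReal (frac K w) ≤ ENNReal.ofReal thr + {w : Cfg N | thr < frac K w}.indicator 1 w := by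
  by_cases h : thr < frac K w
  · rw [indicator_of_mem (show w ∈ {w : Cfg N | thr < frac K w} from h), Pi.one_apply]
    calc ENNReal.ofReal (frac K w) ≤ ENNReal.ofReal 1 := ENNReal.ofReal_le_ofReal (frac_mem_Icc K w).2
      _ = 1 := ENNReal.ofReal_one
      _ ≤ ENNReal.ofReal thr + 1 := le_add_self
  · rw [indicator_of_notMem (show w ∉ {w : Cfg N | thr < frac K w} from h), add_zero]
    exact ENNReal.ofReal_le_ofReal (not_lt.1 h)

/-! ## The orbit inequality -/

-- adapted from …FibrePartOneOfTailsA.lean (`lintegral_orbit_expAvg_le`)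
/-- **Layer cake along a good orbit, split at level `M`.**  For a hard-sphere flow `Φ`, a good `z`, `λ ≥ 0`,
any `t`, `M` and thresholds `thr`:
`∫₀ᵗ (N+1)⁻¹∑ᵢ e^{λ|vᵢ(s)|²} ds ≤ t∑_{K<M} e^{λ(K+1)} thr_K + ∑_{K<M} e^{λ(K+1)} ∫₀ᵗ 𝟙{thr_K < frac_K(Φ_s z)} ds
  + ∑_j e^{λ(j+M+1)} ∫₀ᵗ frac_{j+M}(Φ_s z) ds` (lower Lebesgue integrals; the orbit is measurable in time). -/
theorem pp_lintegral_orbit_expAvg_le {N : ℕ} {ε : ℝ} (Φ : HardSphereFlow (Torus.geometry (Fin 3)) ε (N + 1))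
    {z : Cfg N} (hz : z ∈ Φ.good) {lam : ℝ} (hlam : 0 ≤ lam) (t : ℝ) (M : ℕ) (thr : ℕ → ℝ) :
    ∫⁻ s in Icc 0 t, ENNReal.ofReal (((N + 1 : ℕ) : ℝ)⁻¹ * ∑ i, Real.exp (lam * ‖(Φ.flow s z i).2‖ ^ 2)) ≤
      (∑ K ∈ Finset.range M, ENNReal.ofReal (Real.exp (lam * ((K : ℝ) + 1))) *
          (ENNReal.ofReal (thr K) * ENNReal.ofReal t)) +
      (∑ K ∈ Finset.range M, ENNReal.ofReal (Real.exp (lam * ((K : ℝ) + 1))) *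
          ∫⁻ s in Icc 0 t, {w : Cfg N | thr K < frac (K : ℝ) w}.indicator 1 (Φ.flow s z)) +
      ∑' j : ℕ, ENNReal.ofReal (Real.exp (lam * (((j + M : ℕ) : ℝ) + 1))) *
          ∫⁻ s in Icc 0 t, ENNReal.ofReal (frac ((j + M : ℕ) : ℝ) (Φ.flow s z)) := by
  set ν : Measure ℝ := volume.restrict (Icc 0 t) with hν
  have horb : Measurable fun s => Φ.flow s z := (Φ.isTrajectory z hz).measurable_torus
  set c : ℕ → ℝ≥0∞ := fun K => ENNReal.ofReal (Real.exp (lam * ((K : ℝ) + 1))) with hc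
  set I : ℕ → ℝ≥0∞ := fun K => ∫⁻ s, ENNReal.ofReal (frac (K : ℝ) (Φ.flow s z)) ∂ν with hI
  have hfm : ∀ K : ℕ, Measurable fun s => ENNReal.ofReal (frac (K : ℝ) (Φ.flow s z)) := fun K =>
    ((measurable_frac (K : ℝ)).comp horb).ennreal_ofReal
  -- (1) the layer cake, integrated in time
  have h1 : ∫⁻ s, ENNReal.ofReal (((N + 1 : ℕ) : ℝ)⁻¹ * ∑ i, Real.exp (lam * ‖(Φ.flow s z i).2‖ ^ 2)) ∂ν ≤
      ∑' K : ℕ, c K * I K := by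
    calc ∫⁻ s, ENNReal.ofReal (((N + 1 : ℕ) : ℝ)⁻¹ * ∑ i, Real.exp (lam * ‖(Φ.flow s z i).2‖ ^ 2)) ∂ν
        ≤ ∫⁻ s, ∑' K : ℕ, c K * ENNReal.ofReal (frac (K : ℝ) (Φ.flow s z)) ∂ν :=
          lintegral_mono fun s => pp_ofReal_expAvg_le_tsum hlam (Φ.flow s z)
      _ = ∑' K : ℕ, ∫⁻ s, c K * ENNReal.ofReal (frac (K : ℝ) (Φ.flow s z)) ∂ν :=
          lintegral_tsum fun K => ((hfm K).const_mul _).aemeasurable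
      _ = ∑' K : ℕ, c K * I K := tsum_congr fun K => lintegral_const_mul _ (hfm K)
  -- (2) split the levels at `M`
  have h2 : ∑' K : ℕ, c K * I K = (∑ K ∈ Finset.range M, c K * I K) + ∑' j : ℕ, c (j + M) * I (j + M) :=
    (Summable.sum_add_tsum_nat_add' (f := fun K => c K * I K) ENNReal.summable).symm
  -- (3) the bulk levels: threshold plus bad-event indicator
  have h3 : ∀ K : ℕ, I K ≤ ENNReal.ofReal (thr K) * ENNReal.ofReal t +
      ∫⁻ s, {w : Cfg N | thr K < frac (K : ℝ) w}.indicator 1 (Φ.flow s z) ∂ν := by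
    intro K
    calc I K ≤ ∫⁻ s, ENNReal.ofReal (thr K) + {w : Cfg N | thr K < frac (K : ℝ) w}.indicator 1 (Φ.flow s z) ∂ν :=
          lintegral_mono fun s => pp_ofReal_frac_le_add_indicator (thr K) (K : ℝ) (Φ.flow s z)
      _ = ENNReal.ofReal (thr K) * ENNReal.ofReal t +
          ∫⁻ s, {w : Cfg N | thr K < frac (K : ℝ) w}.indicator 1 (Φ.flow s z) ∂ν := by
          rw [lintegral_add_left measurable_const, lintegral_const, hν, Measure.restrict_apply_univ,
            Real.volume_Icc, sub_zero]
  calc ∫⁻ s, ENNReal.ofReal (((N + 1 : ℕ) : ℝ)⁻¹ * ∑ i, Real.exp (lam * ‖(Φ.flow s z i).2‖ ^ 2)) ∂ν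
      ≤ ∑' K : ℕ, c K * I K := h1
    _ = (∑ K ∈ Finset.range M, c K * I K) + ∑' j : ℕ, c (j + M) * I (j + M) := h2
    _ ≤ (∑ K ∈ Finset.range M, (c K * (ENNReal.ofReal (thr K) * ENNReal.ofReal t) +
          c K * ∫⁻ s, {w : Cfg N | thr K < frac (K : ℝ) w}.indicator 1 (Φ.flow s z) ∂ν)) +
        ∑' j : ℕ, c (j + M) * I (j + M) := by
        gcongr with K hK
        rw [← mul_add]
        exact mul_le_mul' le_rfl (h3 K)
    _ = _ := by rw [Finset.sum_add_distrib]

/-! ## The time-integrated Markov–Tonelli step (registered sub-goal `partOnePrime_markov_step`) -/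

/-- **Time-integrated Markov–Tonelli step of `stub_partOnePrime` (one particle number; registered sub-goal).**
For a hard-sphere flow `Φ` of `N + 1` spheres, a probability law `P` carried by its good set, `λ ≥ 0`, `t > 0`,
`C ≥ 0`, a level cut `M`, nonnegative thresholds `thr_K` with `t∑_{K<M} e^{λ(K+1)} thr_K ≤ tC + 1/2`, bulk bad
events of TIME-INTEGRATED probability `∫₀ᵗ P{thr_K < frac_K(Φ_s ·)} ds ≤ p` (`K < M`) and weighted far occupations
`e^{λ(j+M+1)} E_P ∫₀ᵗ frac_{j+M}(Φ_s ·) ds ≤ B ρ^j` (`0 ≤ ρ < 1`):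
`P{tC + 1 < ∫₀ᵗ (N+1)⁻¹∑ᵢ e^{λ|vᵢ(s)|²} ds} ≤ 2 (p ∑_{K<M} e^{λ(K+1)} + B/(1 − ρ))`. -/
theorem partOnePrime_markov_step : ∀ {N : ℕ} {ε : ℝ} (Φ : HardSphereFlow (Torus.geometry (Fin 3)) ε (N + 1)) (P : Measure (Cfg N)), IsProbabilityMeasure P → P Φ.goodᶜ = 0 → ∀ (lam t C p B ρ : ℝ) (M : ℕ) (thr : ℕ → ℝ), 0 ≤ lam → 0 < t → 0 ≤ C → 0 ≤ p → 0 ≤ B → 0 ≤ ρ → ρ < 1 → (∀ K, 0 ≤ thr K) → t * ∑ K ∈ Finset.range M, Real.exp (lam * ((K : ℝ) + 1)) * thr K ≤ t * C + 1 / 2 → (∀ K ∈ Finset.range M, ∫⁻ s in Icc 0 t, P {z | thr K < frac (K : ℝ) (Φ.flow s z)} ≤ ENNReal.ofReal p) → (∀ j : ℕ, ENNReal.ofReal (Real.exp (lam * (((j + M : ℕ) : ℝ) + 1))) * ∫⁻ z, (∫⁻ s in Icc 0 t, ENNReal.ofReal (frac ((j + M : ℕ) : ℝ) (Φ.flow s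 z))) ∂P ≤ ENNReal.ofReal (B * ρ ^ j)) → P {z | t * C + 1 < ∫ s in Icc 0 t, ((N + 1 : ℕ) : ℝ)⁻¹ * ∑ i, Real.exp (lam * ‖(Φ.flow s z i).2‖ ^ 2)} ≤ ENNReal.ofReal (2 * (p * ∑ K ∈ Finset.range M, Real.exp (lam * ((K : ℝ) + 1)) + B / (1 - ρ))) := by
  intro N ε Φ P hprob hP lam t C p B ρ M thr hlam ht hC0 hp hB hρ hρ1 hthr hC hbulk hfar
  set ν : Measure ℝ := volume.restrict (Icc 0 t) with hν
  -- the observables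
  set c : ℕ → ℝ≥0∞ := fun K => ENNReal.ofReal (Real.exp (lam * ((K : ℝ) + 1))) with hc
  set G : Cfg N → ℝ := fun w => ((N + 1 : ℕ) : ℝ)⁻¹ * ∑ i, Real.exp (lam * ‖(w i).2‖ ^ 2) with hG
  have hGm : Measurable G :=
    measurable_const.mul (Finset.measurable_sum _ fun i _ =>
      (measurable_pi_apply i).snd.norm.pow_const 2 |>.const_mul lam |>.exp)
  have hG0 : ∀ w, 0 ≤ G w := fun w =>
    mul_nonneg (by positivity) (Finset.sum_nonneg fun i _ => (Real.exp_pos _).le)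
  set g : ℕ → Cfg N → ℝ≥0∞ := fun K w => {w : Cfg N | thr K < frac (K : ℝ) w}.indicator 1 w with hg
  have hgm : ∀ K, Measurable (g K) := fun K =>
    measurable_one.indicator (measurableSet_lt measurable_const (measurable_frac _))
  set J : ℕ → Cfg N → ℝ≥0∞ := fun K z => ∫⁻ s, g K (Φ.flow s z) ∂ν with hJ
  set I : ℕ → Cfg N → ℝ≥0∞ := fun K z => ∫⁻ s, ENNReal.ofReal (frac (K : ℝ) (Φ.flow s z)) ∂ν with hI
  set R : Cfg N → ℝ≥0∞ := fun z => (∑ K ∈ Finset.range M, c K * J K z) + ∑' j : ℕ, c (j + M) * I (j + M) z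
    with hR
  set S₁ : ℝ := ∑ K ∈ Finset.range M, Real.exp (lam * ((K : ℝ) + 1)) with hS₁
  have hS₁0 : 0 ≤ S₁ := Finset.sum_nonneg fun K _ => (Real.exp_pos _).le
  -- the deterministic part
  set D : ℝ≥0∞ := ∑ K ∈ Finset.range M, c K * (ENNReal.ofReal (thr K) * ENNReal.ofReal t) with hD
  have hDeq : D = ENNReal.ofReal (t * ∑ K ∈ Finset.range M, Real.exp (lam * ((K : ℝ) + 1)) * thr K) := by
    rw [hD, Finset.mul_sum, ENNReal.ofReal_sum_of_nonneg (fun K _ => by have := hthr K; positivity)]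
    refine Finset.sum_congr rfl fun K _ => ?_
    simp only [hc]
    rw [← ENNReal.ofReal_mul (hthr K), ← ENNReal.ofReal_mul (Real.exp_pos _).le]
    congr 1
    ring
  have hDle : D ≤ ENNReal.ofReal (t * C) + ENNReal.ofReal (1 / 2) := by
    rw [hDeq, ← ENNReal.ofReal_add (mul_nonneg ht.le hC0) (by norm_num)]
    exact ENNReal.ofReal_le_ofReal hC
  -- (1) on the good set the bad event forces `1/2 ≤ R`
  have hincl : {z | t * C + 1 < ∫ s in Icc 0 t, G (Φ.flow s z)} ∩ Φ.good ⊆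
      {z | ENNReal.ofReal (1 / 2) ≤ R z} := by
    rintro z ⟨hz1, hz⟩
    have hz1' : t * C + 1 < ∫ s, G (Φ.flow s z) ∂ν := hz1
    change ENNReal.ofReal (1 / 2) ≤ R z
    have horb : Measurable fun s => Φ.flow s z := (Φ.isTrajectory z hz).measurable_torus
    have hbdd : ∀ s, G (Φ.flow s z) ≤ Real.exp (lam * (2 * configEnergy z)) := fun s => by
      have h := AprioriBoundsNegative.expAvg_le_exp_lam_energy (N := N) hlam (Φ.flow s z)
      rw [Φ.configEnergy_flow hz s] at h
      exact h
    have hGi : Integrable (fun s => G (Φ.flow s z)) ν := by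
      refine Measure.integrableOn_of_bounded (M := Real.exp (lam * (2 * configEnergy z)))
        measure_Icc_lt_top.ne (hGm.comp horb).aestronglyMeasurable (ae_of_all _ fun s => ?_)
      rw [Real.norm_eq_abs, abs_of_nonneg (hG0 _)]
      exact hbdd s
    have hX : ENNReal.ofReal (∫ s, G (Φ.flow s z) ∂ν) = ∫⁻ s, ENNReal.ofReal (G (Φ.flow s z)) ∂ν :=
      ofReal_integral_eq_lintegral_ofReal hGi (ae_of_all _ fun s => hG0 _)
    have hlt : ENNReal.ofReal (t * C) + ENNReal.ofReal (1 / 2) + ENNReal.ofReal (1 / 2) <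
        ∫⁻ s, ENNReal.ofReal (G (Φ.flow s z)) ∂ν := by
      rw [← hX, ← ENNReal.ofReal_add (mul_nonneg ht.le hC0) (by norm_num),
        ← ENNReal.ofReal_add (by positivity) (by norm_num), ENNReal.ofReal_lt_ofReal_iff']
      constructor
      · linarith
      · have : 0 ≤ t * C := mul_nonneg ht.le hC0
        linarith
    have hle : ∫⁻ s, ENNReal.ofReal (G (Φ.flow s z)) ∂ν ≤
        ENNReal.ofReal (t * C) + ENNReal.ofReal (1 / 2) + R z :=
      calc ∫⁻ s, ENNReal.ofReal (G (Φ.flow s z)) ∂ν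
          ≤ D + (∑ K ∈ Finset.range M, c K * J K z) + ∑' j : ℕ, c (j + M) * I (j + M) z :=
            pp_lintegral_orbit_expAvg_le Φ hz hlam t M thr
        _ ≤ (ENNReal.ofReal (t * C) + ENNReal.ofReal (1 / 2)) + (∑ K ∈ Finset.range M, c K * J K z) +
              ∑' j : ℕ, c (j + M) * I (j + M) z := by gcongr
        _ = ENNReal.ofReal (t * C) + ENNReal.ofReal (1 / 2) + R z := by rw [hR, add_assoc]
    exact (lt_of_add_lt_add_left (hlt.trans_le hle)).le
  -- (2) measurability along the flow (Tonelli on `good × [0,t]`)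
  have hJm : ∀ K, AEMeasurable (J K) P := fun K =>
    (aemeasurable_comp_flow_prod₂ Φ ((hgm K).comp measurable_fst) hP ν).lintegral_prod_right'
  have hIm : ∀ K, AEMeasurable (I K) P := fun K =>
    (aemeasurable_comp_flow_prod₂ Φ ((measurable_frac (K : ℝ)).ennreal_ofReal.comp measurable_fst) hP
      ν).lintegral_prod_right'
  have hR1m : AEMeasurable (fun z => ∑ K ∈ Finset.range M, c K * J K z) P :=
    Finset.aemeasurable_fun_sum _ fun K _ => (hJm K).const_mul _
  have hR2m : AEMeasurable (fun z => ∑' j : ℕ, c (j + M) * I (j + M) z) P := by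
    have h : ∀ j, AEMeasurable (fun z => c (j + M) * I (j + M) z) P := fun j => (hIm (j + M)).const_mul _
    simp_rw [ENNReal.tsum_eq_iSup_sum]
    exact AEMeasurable.iSup fun s => Finset.aemeasurable_fun_sum s fun j _ => h j
  have hRm : AEMeasurable R P := hR1m.add hR2m
  -- (3) Markov
  have hhalf0 : ENNReal.ofReal (1 / 2) ≠ 0 := (ENNReal.ofReal_pos.2 one_half_pos).ne'
  have hPE : P {z | t * C + 1 < ∫ s in Icc 0 t, G (Φ.flow s z)} ≤ (∫⁻ z, R z ∂P) / ENNReal.ofReal (1 / 2) := by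
    calc P {z | t * C + 1 < ∫ s in Icc 0 t, G (Φ.flow s z)}
        ≤ P (({z | t * C + 1 < ∫ s in Icc 0 t, G (Φ.flow s z)} ∩ Φ.good) ∪ Φ.goodᶜ) :=
          measure_mono fun z hz => by
            by_cases h : z ∈ Φ.good
            · exact Or.inl ⟨hz, h⟩
            · exact Or.inr h
      _ ≤ P ({z | t * C + 1 < ∫ s in Icc 0 t, G (Φ.flow s z)} ∩ Φ.good) + P Φ.goodᶜ :=
          measure_union_le _ _
      _ = P ({z | t * C + 1 < ∫ s in Icc 0 t, G (Φ.flow s z)} ∩ Φ.good) := by rw [hP, add_zero]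
      _ ≤ P {z | ENNReal.ofReal (1 / 2) ≤ R z} := measure_mono hincl
      _ ≤ (∫⁻ z, R z ∂P) / ENNReal.ofReal (1 / 2) :=
          meas_ge_le_lintegral_div hRm hhalf0 ENNReal.ofReal_ne_top
  -- (4) the expectation of `R`
  have hER : ∫⁻ z, R z ∂P = (∑ K ∈ Finset.range M, c K * ∫⁻ z, J K z ∂P) +
      ∑' j : ℕ, c (j + M) * ∫⁻ z, I (j + M) z ∂P := by
    change ∫⁻ z, (∑ K ∈ Finset.range M, c K * J K z) + ∑' j : ℕ, c (j + M) * I (j + M) z ∂P = _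
    rw [lintegral_add_left' hR1m, lintegral_finsetSum' _ (fun K _ => (hJm K).const_mul _),
      lintegral_tsum (fun j => (hIm (j + M)).const_mul _)]
    congr 1
    · exact Finset.sum_congr rfl fun K _ => lintegral_const_mul'' _ (hJm K)
    · exact tsum_congr fun j => lintegral_const_mul'' _ (hIm (j + M))
  -- Tonelli: `E J_K = ∫₀ᵗ P{bad(K,s)} ds ≤ p` (the time-integrated bulk hypothesis)
  have hEJ : ∀ K ∈ Finset.range M, ∫⁻ z, J K z ∂P ≤ ENNReal.ofReal p := by
    intro K hK
    have hprod := aemeasurable_comp_flow_prod₂ Φ ((hgm K).comp measurable_fst) hP ν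
    change ∫⁻ z, ∫⁻ s, g K (Φ.flow s z) ∂ν ∂P ≤ _
    rw [lintegral_lintegral_swap (f := fun z s => g K (Φ.flow s z)) hprod]
    have hinner : ∀ s, ∫⁻ z, g K (Φ.flow s z) ∂P = P {z | thr K < frac (K : ℝ) (Φ.flow s z)} := by
      intro s
      have hS : MeasurableSet {z | thr K < frac (K : ℝ) (Φ.flow s z)} :=
        measurableSet_lt measurable_const ((measurable_frac (K : ℝ)).comp (Φ.measurable_flow s))
      rw [← lintegral_indicator_one hS]
      rfl
    calc ∫⁻ s, ∫⁻ z, g K (Φ.flow s z) ∂P ∂ν = ∫⁻ s, P {z | thr K < frac (K : ℝ) (Φ.flow s z)} ∂ν :=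
          lintegral_congr fun s => hinner s
      _ ≤ ENNReal.ofReal p := hbulk K hK
  have hER1 : (∑ K ∈ Finset.range M, c K * ∫⁻ z, J K z ∂P) ≤ ENNReal.ofReal (p * S₁) := by
    calc (∑ K ∈ Finset.range M, c K * ∫⁻ z, J K z ∂P)
        ≤ ∑ K ∈ Finset.range M, c K * ENNReal.ofReal p :=
          Finset.sum_le_sum fun K hK => mul_le_mul' le_rfl (hEJ K hK)
      _ = ENNReal.ofReal (p * S₁) := by
          rw [hS₁, Finset.mul_sum, ENNReal.ofReal_sum_of_nonneg (fun K _ => by positivity)]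
          refine Finset.sum_congr rfl fun K _ => ?_
          simp only [hc]
          rw [← ENNReal.ofReal_mul (Real.exp_pos _).le]
          congr 1
          ring
  have hER2 : ∑' j : ℕ, c (j + M) * ∫⁻ z, I (j + M) z ∂P ≤ ENNReal.ofReal (B / (1 - ρ)) := by
    calc ∑' j : ℕ, c (j + M) * ∫⁻ z, I (j + M) z ∂P ≤ ∑' j : ℕ, ENNReal.ofReal B * ENNReal.ofReal ρ ^ j := by
          refine ENNReal.tsum_le_tsum fun j => ?_
          rw [← ENNReal.ofReal_pow hρ, ← ENNReal.ofReal_mul hB]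
          exact hfar j
      _ = ENNReal.ofReal B * (1 - ENNReal.ofReal ρ)⁻¹ := by rw [ENNReal.tsum_mul_left, ENNReal.tsum_geometric]
      _ = ENNReal.ofReal (B / (1 - ρ)) := by
          rw [← ENNReal.ofReal_one, ← ENNReal.ofReal_sub _ hρ, ← ENNReal.ofReal_inv_of_pos (sub_pos.2 hρ1),
            ← ENNReal.ofReal_mul hB, div_eq_mul_inv]
  -- (5) assembly
  have hBρ : 0 ≤ B / (1 - ρ) := div_nonneg hB (sub_pos.2 hρ1).le
  calc P {z | t * C + 1 < ∫ s in Icc 0 t, G (Φ.flow s z)}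
      ≤ (∫⁻ z, R z ∂P) / ENNReal.ofReal (1 / 2) := hPE
    _ ≤ (ENNReal.ofReal (p * S₁) + ENNReal.ofReal (B / (1 - ρ))) / ENNReal.ofReal (1 / 2) := by
        rw [hER]
        exact ENNReal.div_le_div_right (add_le_add hER1 hER2) _
    _ = ENNReal.ofReal (2 * (p * S₁ + B / (1 - ρ))) := by
        rw [← ENNReal.ofReal_add (by positivity) hBρ, ← ENNReal.ofReal_div_of_pos one_half_pos]
        congr 1
        rw [div_eq_mul_inv, one_div, inv_inv, mul_comm]

end Summit.AtomisticToContinuum.HydrodynamicLimit.Theorems.FibreDeficitTransfer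

end
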